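import Literature.Analysis.FluidPDE.KNSSMildDecayProofs
import Literature.Analysis.FluidPDE.OseenMildUniqueness
import HarnessLib

/-!
# Route TypeICertificateLadder — crux `Target` (item stmt-NavierStokesRegularity-1217),
# line `killing-twisted-bernoulli-solitons`: forward uniqueness under a cylindrical bound

Helper file (theorems only) for the helical stratum of the rotating-self-similar Liouville
programme (stub `rssStratum_forward_unique_cyl`). A screw-symmetric RSS profile yields two
classical solutions on `t < 0` (the backward-extended solution and its screw-conjugate) with the
same slice at `t = −1`; the axial translation preserves the cylindrical bound
`|x'| ‖u(t, x)‖ ≤ D` but not the full Type-I bound, whence this generalisation of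
`rssStratum_typeI_forward_unique`: two classical solutions of the unforced Navier–Stokes system
(`ν = 1`) on `ℝ³ × (−∞, 0)` which on the window `(−2, −1/2]` are bounded and satisfy the
horizontal decay `|x'| ‖·(t, x)‖ ≤ D`, and which have the same slice at `t = −1`, coincide on
`(−1, −1/2)`.

Proof. (1) *Mildness* (KNSS 2009, Thm 6.1, mildness clause; tree:
`KNSS2009_mild_of_rMulNorm_bounded_holds`, applied on the window `(−2, 0)` with `T = −1/2`):
for `−1 < t ≤ −1/2`, `u(t) = e^{(t+1)Δ} u(−1) − B¹_{−1}(u, u)(t)` pointwise, and the same for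
`v`; the free terms agree since `u(−1) = v(−1)`. (2) *Uniqueness of bounded solutions of the
Oseen integral equation* (KNSS 2009, §4 (4.3)–(4.4); Giga–Inui–Matsui 1999; tree:
`oseenMild_bounded_unique`): `u(t) = v(t)` a.e. for `t ∈ (−1, −1/2)` (joint measurability from
joint continuity). (3) Both slices are continuous, so `u(t) = v(t)` everywhere
(`Continuous.ae_eq_iff_eq`).
-/

noncomputable section

-- the summit and its single sub-problem share the name (CONVENTIONS §1), as in every Theorems file
set_option linter.dupNamespace false

namespace Summit.NavierStokesRegularity.NavierStokesRegularity.Theorems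

open Set Function Filter MeasureTheory
open Literature.Analysis Literature.Analysis.FluidPDE

/-- **Mildness of bounded classical solutions with horizontal decay, from `t = −1`** (KNSS 2009,
Thm 6.1, mildness clause, through `KNSS2009_mild_of_rMulNorm_bounded_holds` on the window
`(−2, 0)` with `T = −1/2`): if `u` is bounded and `|x'| ‖u(t, x)‖ ≤ D` on `(−2, −1/2]`, then for
`−1 < t ≤ −1/2`, `u(t, x) = (e^{(t+1)Δ} u(−1))(x) − B¹_{−1}(u, u)(t)(x)`. [cite: KochNadirashviliSereginSverak2009, Thm 6.1 (mildness clause), proof last paragraph (arXiv:0709.3599 p. 12)] -/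
private theorem rssStratum_cyl_mild
    {u : ℝ → EuclideanSpace ℝ (Fin 3) → EuclideanSpace ℝ (Fin 3)}
    {p : ℝ → EuclideanSpace ℝ (Fin 3) → ℝ} (hu : IsClassicalNSSolutionOn (Iio 0) 1 0 u p)
    (hL : ∃ L : ℝ, ∀ τ ∈ Ioc (-2 : ℝ) (-(1 / 2)), ∀ y : EuclideanSpace ℝ (Fin 3), ‖u τ y‖ ≤ L)
    (hD : ∃ D : ℝ, ∀ τ ∈ Ioc (-2 : ℝ) (-(1 / 2)), ∀ y : EuclideanSpace ℝ (Fin 3),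
      cylRadius y * ‖u τ y‖ ≤ D)
    {t : ℝ} (h1t : -1 < t) (ht : t ≤ -(1 / 2)) (x : EuclideanSpace ℝ (Fin 3)) :
    u t x = UnboundedOperators.heatExtension (u (-1)) (t - -1) x - oseenDuhamel 1 (-1) u u t x := by
  have hcl : IsClassicalNSSolutionOn (Ioo (-2) 0) 1 0 u p :=
    hu.mono Ioo_subset_Iio_self (uniqueDiffOn_Ioo _ _)
  exact KNSS2009_mild_of_rMulNorm_bounded_holds hcl (by norm_num) (by norm_num) hL hD
    (s := -1) (t := t) (by norm_num) h1t ht x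

/-- **Forward uniqueness under boundedness and a cylindrical bound.** Two classical solutions
`(u, p)`, `(v, q)` of the unforced Navier–Stokes system (`ν = 1`) on `ℝ³ × (−∞, 0)` which are
bounded and satisfy the horizontal decay `|x'| ‖·(t, x)‖ ≤ D` on the window `(−2, −1/2]`, and
which have the same slice at `t = −1`, coincide at every `t ∈ (−1, −1/2)`. Proof: both are mild
from `t = −1` with the same free term `e^{(t+1)Δ} u(−1)` (KNSS 2009, Thm 6.1,
`rssStratum_cyl_mild`), bounded and jointly continuous on the window, so they agree a.e. at every
time by uniqueness of bounded solutions of the Oseen integral equation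
(`oseenMild_bounded_unique`, KNSS 2009 §4 (4.3)–(4.4)), hence everywhere by continuity of the
slices. [cite: KochNadirashviliSereginSverak2009, Thm 6.1 and §4 (4.3)–(4.4) (arXiv:0709.3599 pp. 8, 11–12)] -/
theorem rssStratum_forward_unique_cyl : ∀ (u v : ℝ → EuclideanSpace ℝ (Fin 3) → EuclideanSpace ℝ (Fin 3)) (p q : ℝ → EuclideanSpace ℝ (Fin 3) → ℝ), Literature.Analysis.FluidPDE.IsClassicalNSSolutionOn (Set.Iio 0) 1 0 u p → Literature.Analysis.FluidPDE.IsClassicalNSSolutionOn (Set.Iio 0) 1 0 v q → (∃ L : ℝ, ∀ t ∈ Set.Ioc (-2 : ℝ) (-(1 / 2)), ∀ x : EuclideanSpace ℝ (Fin 3), ‖u t x‖ ≤ L ∧ ‖v t x‖ ≤ L) → (∃ D : ℝ, ∀ t ∈ Set.Ioc (-2 : ℝ) (-(1 / 2)), ∀ x : EuclideanSpace ℝ (Fin 3), Literature.Analysis.FluidPDE.cylRadius x * ‖u t x‖ ≤ D ∧ Literature.Analysis.FluidPDE.cylRadius x * ‖v t x‖ ≤ D) → u (-1) = v (-1) → ∀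 t ∈ Set.Ioo (-1 : ℝ) (-(1 / 2)), u t = v t := by
  intro u v p q hu hv hB hD h0 t ht
  obtain ⟨L, hL⟩ := hB
  obtain ⟨D, hD⟩ := hD
  -- `0 ≤ L`: evaluate the bound at `t = -1`, `x = 0`
  have hL0 : 0 ≤ L :=
    (norm_nonneg _).trans (hL (-1) ⟨by norm_num, by norm_num⟩ 0).1
  have hsub : Ioo (-1 : ℝ) (-(1 / 2)) ⊆ Iio 0 := fun τ hτ => hτ.2.trans (by norm_num)
  have hsub' : Ioo (-1 : ℝ) (-(1 / 2)) ⊆ Ioc (-2 : ℝ) (-(1 / 2)) :=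
    fun τ hτ => ⟨by linarith [hτ.1], hτ.2.le⟩
  -- joint measurability on the window, from joint continuity
  have hmeas : ∀ {w : ℝ → EuclideanSpace ℝ (Fin 3) → EuclideanSpace ℝ (Fin 3)}
      {r : ℝ → EuclideanSpace ℝ (Fin 3) → ℝ}, IsClassicalNSSolutionOn (Iio 0) 1 0 w r →
      AEStronglyMeasurable (uncurry w)
        ((volume : Measure (ℝ × EuclideanSpace ℝ (Fin 3))).restrict
          (Ioo (-1 : ℝ) (-(1 / 2)) ×ˢ univ)) := by
    intro w r hw
    have hc : ContinuousOn (uncurry w) (Ioo (-1 : ℝ) (-(1 / 2)) ×ˢ univ) :=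
      hw.smooth_velocity.continuousOn.mono (prod_mono hsub Subset.rfl)
    exact hc.aestronglyMeasurable (measurableSet_Ioo.prod MeasurableSet.univ)
  -- mildness from `s = -1` of both fields (KNSS 2009, Thm 6.1)
  have hmu : ∀ τ ∈ Ioo (-1 : ℝ) (-(1 / 2)), ∀ y,
      u τ y = UnboundedOperators.heatExtension (u (-1)) (τ - -1) y - oseenDuhamel 1 (-1) u u τ y :=
    fun τ hτ y => rssStratum_cyl_mild hu ⟨L, fun σ hσ z => (hL σ hσ z).1⟩
      ⟨D, fun σ hσ z => (hD σ hσ z).1⟩ hτ.1 hτ.2.le y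
  have hmv : ∀ τ ∈ Ioo (-1 : ℝ) (-(1 / 2)), ∀ y,
      v τ y = UnboundedOperators.heatExtension (u (-1)) (τ - -1) y - oseenDuhamel 1 (-1) v v τ y := by
    intro τ hτ y
    have h := rssStratum_cyl_mild hv ⟨L, fun σ hσ z => (hL σ hσ z).2⟩
      ⟨D, fun σ hσ z => (hD σ hσ z).2⟩ hτ.1 hτ.2.le y
    rw [← h0] at h
    exact h
  -- uniqueness of bounded solutions of the Oseen integral equation from `s = -1`
  have key := oseenMild_bounded_unique (ν := 1) (M := L) (s := -1) (T := -(1 / 2))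
    (u := u) (v := v)
    (U := fun τ y => UnboundedOperators.heatExtension (u (-1)) (τ - -1) y)
    one_pos hL0 (hmeas hu) (hmeas hv)
    (fun τ hτ y => (hL τ (hsub' hτ) y).1)
    (fun τ hτ y => (hL τ (hsub' hτ) y).2)
    (fun τ hτ => Eventually.of_forall fun y => hmu τ hτ y)
    (fun τ hτ => Eventually.of_forall fun y => hmv τ hτ y)
  -- from a.e. to everywhere: both slices are continuous
  have hcu : Continuous (u t) := (hu.contDiff_velocity (hsub ht)).continuous
  have hcv : Continuous (v t) := (hv.contDiff_velocity (hsub ht)).continuous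
  exact (hcu.ae_eq_iff_eq volume hcv).1 (key t ht)

end Summit.NavierStokesRegularity.NavierStokesRegularity.Theorems

end
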